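import Mathlib
import Summits.ValiantsHypothesis.ValiantsHypothesis.Theorems.FifoMatchingNNLinearDegreeCofactorHardShedWordHeartPopped
import HarnessLib

/-!
# Crux `NNLinearDegreeCofactorHard` (stmt-ValiantsHypothesis-23918), line `internal_cofactor`, stub S2b (ii):
# the popped heart with the free mass counted in ITEMS (adversary round `Cruxes/…/ADVERSARY-p3.md`, hazard H3)

`ShedWord.heart_popped` has the free-mass deficit `N/6 − 2·#R − (N − E) − H − 2F₀ − 6w` (`F₀ = freeCount R 0 H`).  In the
a = 28 interface (`…AvoidingCountsOfPricing`) the carving is universally quantified with `2n ≤ 2C.m + 12|R| + 4` only, so the trace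
density `#R/N` reaches `1/16`, and the drain needs `N − E ≥ #R + F₀ + w`: then `2·#R + (N − E) ≥ 3N/16 > N/6` and the deficit is `0` in `ℕ`
— the dichotomy says nothing.  The loss is bookkeeping, repaired here with the SAME proof:

* `defectCount_le_card` — `defectCount R a b ≤ #R`;
* `pushes_sub_pushes_le_sPush_add_defectCount` — pushes in `[u,v)` ≤ S-pushes + defects IN `[u,v)` (not `+ #R`);
* `card_rItems_lt_le_defectCount` — the R-items of index `< pushes (prefix u)` number at most `defectCount R 0 u` (so early R-items
  and late R-pushes together are charged `#R` ONCE);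
* `two_mul_pushes_tail_le` — by final balance the tail `[E, N)` holds at most `(N − E)/2` pushes (not `N − E`);
* `heart_popped_tight` — `N/6 − #R − (N−E)/2 − H − 2F₀ − 6w ≤ (F₀ + w)·sBoundariesPopped ∨ F₀ − w ≤ testsAll + 2w(2·sBoundariesPopped + 1)`,
  positive deficit for every trace density `< 2/21`, i.e. for every `a ≥ 23` of the interface family.

Nothing here proves S2b, the crux or VP ≠ VNP (not proved). [folklore]
-/

noncomputable section

-- Sub = Summit single-conjunct layout: the duplicated namespace component is mandated by the tree.
set_option linter.dupNamespace false

namespace Summit.ValiantsHypothesis.ValiantsHypothesis.Theorems.FifoMatching.NNLinearDegreeCofactorHard.ShedWord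

open Finset Literature.Computability.AlgebraicComplexity
open Summit.ValiantsHypothesis.ValiantsHypothesis.Theorems.FifoMatching.NNMonotoneHard
open Summit.ValiantsHypothesis.ValiantsHypothesis.Theorems.FifoMatching.NNLinearDegreeCofactorHard.QueueHistory

variable {N : ℕ} (R : Finset (Fin N)) (H E : ℕ) (y : Fin N → Bool)

/-! ### Item-level bookkeeping -/

/-- Defects in a window number at most `#R`. [folklore] -/
theorem defectCount_le_card (a b : ℕ) : defectCount R a b ≤ R.card := by
  classical
  unfold defectCount
  calc ((range b).filter fun t => a ≤ t ∧ isDefect R t = true).card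
      ≤ (R.map Fin.valEmbedding).card := by
        refine card_le_card fun t ht => ?_
        rw [mem_filter] at ht
        simpa [isDefect] using ht.2.2
    _ = R.card := card_map _

/-- **Pushes in `[u, v)` = S-pushes + R-pushes, and the R-pushes are at the defects OF `[u, v)`** (`v ≤ N`). [folklore] -/
theorem pushes_sub_pushes_le_sPush_add_defectCount {u v : ℕ} (huv : u ≤ v) (hvN : v ≤ N) :
    pushes (shedPrefix R H E y v) - pushes (shedPrefix R H E y u) ≤
      sPush (shedLetter R H E y) (fun s => pushes (shedPrefix R H E y s)) (isRItem R H E y) u v + defectCount R u v := by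
  classical
  rw [pushes_sub_pushes R H E y huv]
  have hsplit : ((Ico u v).filter fun t => shedLetter R H E y t = true) ⊆
      ((Ico u v).filter fun t => shedLetter R H E y t = true ∧ isRItem R H E y (pushes (shedPrefix R H E y t)) = false) ∪
        ((range v).filter fun t => u ≤ t ∧ isDefect R t = true) := by
    intro t ht
    rw [mem_filter, mem_Ico] at ht
    rw [mem_union, mem_filter, mem_filter, mem_Ico, mem_range]
    by_cases hr : isRItem R H E y (pushes (shedPrefix R H E y t)) = false
    · exact Or.inl ⟨ht.1, ht.2, hr⟩
    · right
      rw [Bool.not_eq_false, isRItem_pushes R H E y (lt_of_lt_of_le ht.1.2 hvN) ht.2] at hr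
      exact ⟨ht.1.2, ht.1.1, hr⟩
  refine (card_le_card hsplit).trans ((card_union_le _ _).trans ?_)
  unfold sPush defectCount
  exact le_rfl

/-- **The R-items of index `< pushes (prefix u)` (pushed before `u`) number at most the defects of `[0, u)`.** [folklore] -/
theorem card_rItems_lt_le_defectCount {u : ℕ} (huN : u ≤ N) :
    ((range (pushes (shedPrefix R H E y u))).filter fun k => isRItem R H E y k = true).card ≤ defectCount R 0 u := by
  classical
  set A := (range (pushes (shedPrefix R H E y u))).filter fun k => isRItem R H E y k = true with hA
  have hlt : ∀ k ∈ A, k < (openerSet (shedWord R H E y)).card := by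
    intro k hk
    rw [hA, mem_filter, mem_range] at hk
    rw [← pushes_shedPrefix_N]
    exact lt_of_lt_of_le hk.1 (pushes_mono R H E y huN)
  have hinj : Set.InjOn (openTime R H E y) ↑A := by
    intro k₁ h₁ k₂ h₂ heq
    have h₁' := hlt k₁ (mem_coe.1 h₁)
    have h₂' := hlt k₂ (mem_coe.1 h₂)
    unfold openTime at heq
    rw [dif_pos h₁', dif_pos h₂'] at heq
    have := ((openerSet (shedWord R H E y)).orderEmbOfFin rfl).injective (Fin.ext heq)
    simpa using this
  have hsub : A.image (openTime R H E y) ⊆ (range u).filter fun t => 0 ≤ t ∧ isDefect R t = true := by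
    intro t ht
    rw [mem_image] at ht
    obtain ⟨k, hk, rfl⟩ := ht
    have hk' := hlt k hk
    rw [hA, mem_filter, mem_range] at hk
    rw [mem_filter, mem_range]
    refine ⟨(openTime_lt_iff R H E y hk' u).2 hk.1, Nat.zero_le _, ?_⟩
    have h := hk.2
    unfold isRItem at h
    rwa [← openTime_eq_nthTrue R H E y hk'] at h
  have h1 : A.card = (A.image (openTime R H E y)).card := (card_image_of_injOn hinj).symm
  have h2 := card_le_card hsub
  unfold defectCount
  omega

/-- **The tail holds at most half pushes**: for a balanced word with a non-empty queue at `E`,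
`2·(pushes N − pushes E) ≤ N − E`. [folklore] -/
theorem two_mul_pushes_tail_le (hbal : (closerSet (shedWord R H E y)).card = (openerSet (shedWord R H E y)).card)
    (hEN : E ≤ N) (hne : pops (shedPrefix R H E y E) ≤ pushes (shedPrefix R H E y E)) :
    2 * (pushes (shedPrefix R H E y N) - pushes (shedPrefix R H E y E)) ≤ N - E := by
  have hN := pushes_add_pops (shedPrefix R H E y N)
  have hE := pushes_add_pops (shedPrefix R H E y E)
  rw [length_shedPrefix] at hN hE
  have hb : pushes (shedPrefix R H E y N) = pops (shedPrefix R H E y N) := by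
    rw [pushes_shedPrefix_N, pops_shedPrefix_N, hbal]
  have hm := pops_mono R H E y hEN
  have hm' := pushes_mono R H E y hEN
  omega

/-! ### The heart with the item count -/

/-- **(D*) for μ* = shedWord, S-boundaries popped before `E`, free mass counted in items.** [folklore] -/
theorem heart_popped_tight (hbal : (closerSet (shedWord R H E y)).card = (openerSet (shedWord R H E y)).card)
    (hHE : H ≤ E) (hEN : E ≤ N) {w : ℕ} (hw : w ≤ freeCount R 0 H)
    (hband : ∀ s, H ≤ s → s ≤ E → |fairWalk R H E y s| < w)
    (S : Finset (Fin N)) (hS₁ : N < 3 * S.card) (hS₂ : 3 * S.card ≤ 2 * N)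
    (hresp : ∀ i, i ∈ S ↔ fifo (shedWord R H E y) hbal i ∈ S) :
    N / 6 - R.card - (N - E) / 2 - H - 2 * freeCount R 0 H - 6 * w ≤ (freeCount R 0 H + w) * sBoundariesPopped R H E y S ∨
      freeCount R 0 H - w ≤ testsAll R H E y S + 2 * w * (2 * sBoundariesPopped R H E y S + 1) := by
  classical
  -- axioms of the abstract history
  have hO0 : (fun s => pushes (shedPrefix R H E y s)) 0 = 0 := rfl
  have hC0 : (fun s => pops (shedPrefix R H E y s)) 0 = 0 := rfl
  have hOs : ∀ t, (fun s => pushes (shedPrefix R H E y s)) (t + 1) =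
      (fun s => pushes (shedPrefix R H E y s)) t + (if shedLetter R H E y t = true then 1 else 0) := fun t => rankO_succ R H E y t
  have hCs : ∀ t, (fun s => pops (shedPrefix R H E y s)) (t + 1) =
      (fun s => pops (shedPrefix R H E y s)) t + (if shedLetter R H E y t = true then 0 else 1) := fun t => rankC_succ R H E y t
  have ho : ∀ k t, k < (openerSet (shedWord R H E y)).card →
      (openTime R H E y k < t ↔ k < (fun s => pushes (shedPrefix R H E y s)) t) := fun k t hk => openTime_lt_iff R H E y hk t
  have hc : ∀ k t, k < (openerSet (shedWord R H E y)).card →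
      (closeTime R H E y hbal k < t ↔ k < (fun s => pops (shedPrefix R H E y s)) t) :=
    fun k t hk => closeTime_lt_iff R H E y hbal hk t
  have hrespn : ∀ k, k < (openerSet (shedWord R H E y)).card →
      posColour S (openTime R H E y k) = posColour S (closeTime R H E y hbal k) := by
    intro k hk
    have h := colour_openTime_eq R H E y hbal S hresp hk
    simp only [posColour]
    rw [decide_eq_decide]; exact h
  -- the queue is non-empty at `E` (band), so the tail holds at most `(N − E)/2` pushes
  have hneE : pops (shedPrefix R H E y E) < pushes (shedPrefix R H E y E) :=
    (sContent_mem_band R H E y hEN hw hHE le_rfl fun s h1 h2 => hband s h1 h2).2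
  have htail := two_mul_pushes_tail_le R H E y hbal hEN (le_of_lt hneE)
  have hRle : ∀ a b, defectCount R a b ≤ R.card := defectCount_le_card R
  -- generations
  set T := genTime (closeTime R H E y hbal) (fun s => pushes (shedPrefix R H E y s)) H with hT
  obtain ⟨hgens, hex⟩ := gens_shedWord R H E y hbal hHE hEN hw hband
  have hTgt : E < T (Nat.find hex + 1) := Nat.find_spec hex
  have hTmin : ∀ j < Nat.find hex, ¬ E < T (j + 1) := fun j hj => Nat.find_min hex hj
  generalize hmB : Nat.find hex = mB at hTgt hTmin
  have hTle : ∀ j ≤ mB, T j ≤ E := by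
    intro j hj
    cases j with
    | zero => exact hHE
    | succ j => exact not_lt.1 (hTmin j (Nat.lt_of_succ_le hj))
  have hG := hgens mB hTle
  -- the degenerate case: less than one complete generation before `E`
  by_cases hmB0 : mB = 0
  · left
    have hn' : 2 * (openerSet (shedWord R H E y)).card = N := by
      have h1 := pushes_add_pops (shedPrefix R H E y N)
      rw [length_shedPrefix, pushes_shedPrefix_N, pops_shedPrefix_N, hbal] at h1; omega
    have hfill : pushes (shedPrefix R H E y H) = H := pushes_fill R H E y le_rfl
    have h2 := pushes_sub_pushes_le_sPush_add_defectCount R H E y hHE hEN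
    have h2' := hRle H E
    have hne0 := (hG 0 (Nat.zero_le _)).2.1
    have h3 : sPush (shedLetter R H E y) (fun s => pushes (shedPrefix R H E y s)) (isRItem R H E y) H E ≤
        sPop (shedLetter R H E y) (fun s => pops (shedPrefix R H E y s)) (isRItem R H E y) H E + 2 * w :=
      sPush_le_sPop_add R H E y hEN hw le_rfl hHE le_rfl hband
    have h4 : sPop (shedLetter R H E y) (fun s => pops (shedPrefix R H E y s)) (isRItem R H E y) H E ≤ sContent R H E y H := by
      have hT1 : E ≤ gen (closeTime R H E y hbal) (fun s => pushes (shedPrefix R H E y s)) H := by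
        have := hTgt; rw [hmB0] at this; exact le_of_lt this
      exact sPop_le_sAlive R H E y hbal S hne0 (hHE.trans hEN) hT1
    have h5 : sContent R H E y H ≤ freeCount R 0 H + w := by
      have := (sContent_mem_band R H E y hEN hw le_rfl hHE fun s h1 h2 => hband s h1 (h2.trans hHE)).1.2; omega
    have hmono := pushes_mono R H E y hHE
    have hmono' := pushes_mono R H E y hEN
    rw [pushes_shedPrefix_N] at htail hmono'
    have : N / 6 - R.card - (N - E) / 2 - H - 2 * freeCount R 0 H - 6 * w = 0 := by omega
    rw [this]; exact Nat.zero_le _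
  obtain ⟨m', hm'⟩ : ∃ m', mB = m' + 1 := ⟨mB - 1, by omega⟩
  have hne : ∀ j ≤ mB, (fun s => pops (shedPrefix R H E y s)) (T j) < (fun s => pushes (shedPrefix R H E y s)) (T j) :=
    fun j hj => (hG j hj).2.1
  have hn : ∀ j ≤ mB, (fun s => pushes (shedPrefix R H E y s)) (T j) ≤ (openerSet (shedWord R H E y)).card := fun j hj => by
    show pushes _ ≤ _; rw [← pushes_shedPrefix_N]; exact pushes_mono R H E y ((hTle j hj).trans hEN)
  have hHT : ∀ j ≤ mB, H ≤ T j := fun j hj => (hG j hj).1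
  -- NS
  have hNS : ∀ t, H ≤ t → t < T m' → shedLetter R H E y t = true →
      (fun k => !isRItem R H E y k) ((fun s => pushes (shedPrefix R H E y s)) t) = true →
      (fun k => !isRItem R H E y k) ((fun s => pops (shedPrefix R H E y s)) t) = true := by
    intro t hHt htT hpush hS
    have htE : t < E := lt_of_lt_of_le htT (hTle m' (by omega))
    have hne' := (sContent_mem_band R H E y hEN hw hHt (le_of_lt htE) fun s h1 h2 => hband s h1 (h2.trans (le_of_lt htE))).2
    exact ns_shedWord R H E y hEN hHt htE hne' hpush hS
  -- band windows
  have hbandw : ∀ j < m', ∀ u v, T j ≤ u → u ≤ v → v ≤ T (j + 1) →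
      sPush (shedLetter R H E y) (fun s => pushes (shedPrefix R H E y s)) (fun k => !(fun k => !isRItem R H E y k) k) u v ≤
        sPop (shedLetter R H E y) (fun s => pops (shedPrefix R H E y s)) (fun k => !(fun k => !isRItem R H E y k) k) u v + 2 * w := by
    intro j hj u v hu huv hv
    simp only [Bool.not_not]
    exact sPush_le_sPop_add R H E y hEN hw ((hHT j (by omega)).trans hu) huv (hv.trans (hTle (j + 1) (by omega))) hband
  -- band on the alive S-count
  have hZ : ∀ j ≤ mB, freeCount R 0 H - w ≤ sAlive (fun s => pushes (shedPrefix R H E y s)) (fun s => pops (shedPrefix R H E y s))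
      (fun k => !isRItem R H E y k) (T j) ∧ sAlive (fun s => pushes (shedPrefix R H E y s)) (fun s => pops (shedPrefix R H E y s))
      (fun k => !isRItem R H E y k) (T j) ≤ freeCount R 0 H + w := by
    intro j hj
    rw [sAlive_eq_sContent]
    have h := (sContent_mem_band R H E y hEN hw (hHT j hj) (hTle j hj) fun s h1 h2 => hband s h1 (h2.trans (hTle j hj))).1
    omega
  -- free mass
  have hOM : (fun s => pushes (shedPrefix R H E y s)) N = (openerSet (shedWord R H E y)).card := pushes_shedPrefix_N R H E y
  have hCM : (fun s => pops (shedPrefix R H E y s)) N = (openerSet (shedWord R H E y)).card := by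
    show pops _ = _; rw [pops_shedPrefix_N, hbal]
  have hcol : ((range N).filter fun t => posColour S t = true).card = S.card := card_filter_posColour S
  have hsix : ∀ b : Bool, N ≤ 6 * ((range (openerSet (shedWord R H E y)).card).filter fun k =>
      posColour S (openTime R H E y k) = b).card := fun b =>
    le_six_mul_card_items_colour (σ := posColour S) hOs hCs ho hc hrespn hOM hCM (by rw [hcol]; exact hS₁) (by rw [hcol]; exact hS₂) b
  -- uncovered items: pushes in `[T m', N)` — S-pushes of two generations, the defects OF `[T m', E)`, and half the tail
  have hpopsH : pops (shedPrefix R H E y H) = 0 := pops_fill R H E y le_rfl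
  have hTm'E : T m' ≤ E := hTle m' (by omega)
  have hunc : 2 * ((openerSet (shedWord R H E y)).card - pushes (shedPrefix R H E y (T m'))) ≤
      (N - E) + 2 * defectCount R (T m') E + 4 * ((freeCount R 0 H + w) + 2 * w) := by
    have hTm : T m' ≤ T mB := le_of_lt (by rw [hm']; exact (hG m' (by omega)).2.2)
    have h2 := pushes_sub_pushes_le_sPush_add_defectCount R H E y hTm'E hEN
    have hsplit : sPush (shedLetter R H E y) (fun s => pushes (shedPrefix R H E y s)) (isRItem R H E y) (T m') E =
        sPush (shedLetter R H E y) (fun s => pushes (shedPrefix R H E y s)) (isRItem R H E y) (T m') (T mB) +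
        sPush (shedLetter R H E y) (fun s => pushes (shedPrefix R H E y s)) (isRItem R H E y) (T mB) E := by
      unfold sPush; exact card_filter_Ico_add _ hTm (hTle mB le_rfl)
    have h3a : sPush (shedLetter R H E y) (fun s => pushes (shedPrefix R H E y s)) (isRItem R H E y) (T m') (T mB) ≤
        sPop (shedLetter R H E y) (fun s => pops (shedPrefix R H E y s)) (isRItem R H E y) (T m') (T mB) + 2 * w :=
      sPush_le_sPop_add R H E y hEN hw (hHT m' (by omega)) hTm (hTle mB le_rfl) hband
    have h3b : sPush (shedLetter R H E y) (fun s => pushes (shedPrefix R H E y s)) (isRItem R H E y) (T mB) E ≤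
        sPop (shedLetter R H E y) (fun s => pops (shedPrefix R H E y s)) (isRItem R H E y) (T mB) E + 2 * w :=
      sPush_le_sPop_add R H E y hEN hw (hHT mB le_rfl) (hTle mB le_rfl) le_rfl hband
    have h4a : sPop (shedLetter R H E y) (fun s => pops (shedPrefix R H E y s)) (isRItem R H E y) (T m') (T mB) ≤ sContent R H E y (T m') :=
      sPop_le_sAlive R H E y hbal S (hne m' (by omega)) ((hTle m' (by omega)).trans hEN) (by rw [hm']; exact le_rfl)
    have h4b : sPop (shedLetter R H E y) (fun s => pops (shedPrefix R H E y s)) (isRItem R H E y) (T mB) E ≤ sContent R H E y (T mB) :=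
      sPop_le_sAlive R H E y hbal S (hne mB le_rfl) ((hTle mB le_rfl).trans hEN) (le_of_lt hTgt)
    have h5a := ((hZ m' (by omega)).2)
    have h5b := ((hZ mB le_rfl).2)
    rw [sAlive_eq_sContent] at h5a h5b
    rw [← pushes_shedPrefix_N]
    have hmono := pushes_mono R H E y (hTle m' (by omega))
    have hmono' := pushes_mono R H E y hEN
    omega
  have hQ : ∀ b : Bool, N / 6 - R.card - (N - E) / 2 - H - 2 * freeCount R 0 H - 6 * w ≤
      ((Ico ((fun s => pops (shedPrefix R H E y s)) H) ((fun s => pushes (shedPrefix R H E y s)) (T m'))).filter fun k =>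
        (fun k => !isRItem R H E y k) k = true ∧ posColour S (openTime R H E y k) = b).card := by
    intro b
    -- cover: mid S-items of colour `b` ∪ EARLY R-items (index `< pushes (T m')`) ∪ late items
    have hcover : ((range (openerSet (shedWord R H E y)).card).filter fun k => posColour S (openTime R H E y k) = b) ⊆
        (((Ico (pops (shedPrefix R H E y H)) (pushes (shedPrefix R H E y (T m')))).filter fun k =>
            (!isRItem R H E y k) = true ∧ posColour S (openTime R H E y k) = b) ∪
          ((range (pushes (shedPrefix R H E y (T m')))).filter fun k => isRItem R H E y k = true)) ∪
          Ico (pushes (shedPrefix R H E y (T m'))) (openerSet (shedWord R H E y)).card := by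
      intro k hk
      rw [mem_filter, mem_range] at hk
      rw [mem_union, mem_union, mem_filter, mem_filter, mem_Ico, mem_Ico, mem_range, hpopsH]
      by_cases hlt : k < pushes (shedPrefix R H E y (T m'))
      · by_cases hr : isRItem R H E y k = true
        · exact Or.inl (Or.inr ⟨hlt, hr⟩)
        · exact Or.inl (Or.inl ⟨⟨Nat.zero_le _, hlt⟩, by simpa using hr, hk.2⟩)
      · exact Or.inr ⟨not_lt.1 hlt, hk.1⟩
    have h1 := (card_le_card hcover).trans ((card_union_le _ _).trans (Nat.add_le_add_right (card_union_le _ _) _))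
    rw [Nat.card_Ico] at h1
    have h2 := card_rItems_lt_le_defectCount R H E y (hTm'E.trans hEN)
    have h2' : defectCount R 0 (T m') + defectCount R (T m') E ≤ R.card := by
      rw [← defectCount_add R (Nat.zero_le _) hTm'E]; exact hRle 0 E
    have h3 := hsix b
    have h4 := hunc
    simp only []
    omega
  -- the dichotomy
  have hD := dichotomy (W := shedLetter R H E y) (σ := posColour S) (rO := fun s => pushes (shedPrefix R H E y s))
    (rC := fun s => pops (shedPrefix R H E y s)) (o := openTime R H E y) (c := closeTime R H E y hbal)
    (n' := (openerSet (shedWord R H E y)).card) (isS := fun k => !isRItem R H E y k) hOs hCs ho hc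
    (A := H) (m := m') (D := 2 * w) (Zmax := freeCount R 0 H + w) (Zmin := freeCount R 0 H - w)
    (Q := N / 6 - R.card - (N - E) / 2 - H - 2 * freeCount R 0 H - 6 * w)
    (fun j hj => hne j (by omega)) (fun j hj => hn j (by omega)) hNS hbandw (fun j hj => (hZ j (by omega)).2) (fun j hj => (hZ j (by omega)).1) hQ
  -- weaken to the popped-window quantities
  have hSbd : sBd (posColour S) (openTime R H E y) (fun k => !isRItem R H E y k) ((fun s => pops (shedPrefix R H E y s)) H)
      ((fun s => pushes (shedPrefix R H E y s)) (T m')) ≤ sBoundariesPopped R H E y S := by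
    unfold sBoundariesPopped sBd
    refine card_le_card (filter_subset_filter _ (Ioo_subset_Ioo (by simp [hpopsH]) ?_))
    have h1 : pops (shedPrefix R H E y (T mB)) = pushes (shedPrefix R H E y (T m')) := by
      rw [hm']
      exact rankC_genTime_succ (c := closeTime R H E y hbal) (rO := fun s => pushes (shedPrefix R H E y s))
        (rC := fun s => pops (shedPrefix R H E y s)) hCs hc (A := H) (m := mB)
        hne hn (by omega)
    show pushes (shedPrefix R H E y (T m')) ≤ pops (shedPrefix R H E y E)
    rw [← h1]; exact pops_mono R H E y (hTle mB le_rfl)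
  have hTests : sTests (shedLetter R H E y) (posColour S) (fun s => pushes (shedPrefix R H E y s))
      (fun s => pops (shedPrefix R H E y s)) (openTime R H E y) (fun k => !(fun k => !isRItem R H E y k) k) H (T m') ≤
      testsAll R H E y S := by
    unfold testsAll sTests
    refine card_le_card fun t ht => ?_
    rw [mem_filter, mem_Ico] at ht ⊢
    refine ⟨⟨ht.1.1, lt_of_lt_of_le ht.1.2 (hTle m' (by omega))⟩, ht.2.1, ?_, ht.2.2.2⟩
    simpa using ht.2.2.1
  rcases hD with h | h
  · left
    exact h.trans (Nat.mul_le_mul_left _ hSbd)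
  · right
    exact h.trans (Nat.add_le_add hTests (Nat.mul_le_mul_left _ (Nat.add_le_add_right (Nat.mul_le_mul_left _ hSbd) 1)))

end Summit.ValiantsHypothesis.ValiantsHypothesis.Theorems.FifoMatching.NNLinearDegreeCofactorHard.ShedWord
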